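import Mathlib.Analysis.InnerProductSpace.PiL2
import Mathlib.Analysis.InnerProductSpace.Calculus
import Mathlib.Analysis.Calculus.ContDiff.RCLike
import Summits.SmoothPoincare4.SmoothPoincare4.Theorems.DottedCircleRasmussenDcrGapHelperFriendsCarrierVkPartBLogCutoff

/-!
# Helper `helper_friendsCarrier_Vk_partB_rayMono` (piece of the registered stub
`helper_friendsCarrier_Vk_partB`, line `mk_friends`, skeleton v8) for crux `DcrGap`
(item stmt-SmoothPoincare4-16128, route route-SmoothPoincare4-DottedCircleRasmussen)

**Monotonicity of the logarithmically blended radius along the rays.**  Let `ρ : ℝ² → ℝ` be `C^∞` on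
the annulus `|‖x‖ - 1| < τ` (`0 < τ ≤ 1/2`) with `|ρ - 1| < 1/2`, positive radial derivative `dρₓ(x) > 0`
and `ρ = 1` on the unit circle (the level-parametrised radius of `…VkPartBRayRadius`).  With the
logarithmic cutoff `β` of `…VkPartBLogCutoff` (`β = 0` below `1 - τ/2`, `β = 1` above `1 - τ₁`,
`|β'(t)| (1 - t) ≤ κ`) the blended radius along the ray through a unit vector `u` is
`r_u(t) = t^{1 - β(t)} ρ(t u)^{β(t)} = exp E_u(t)`, `E_u(t) = log t + β(t) (log ρ(t u) - log t)`, and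

  `E_u'(t) = (1 - β)/t + β ∂_t ρ(t u)/ρ(t u) + β'(t) (log ρ(t u) - log t)`.

The first two terms are at least `min(1, 2m₁/3) =: m` (`m₁ ≤ dρₓ(x) ≤ M₁` on the compact annulus
`1 - τ/2 ≤ ‖x‖ ≤ 1 + τ/2`), while `|log ρ(t u) - log t| ≤ (4M₁ + 2)(1 - t)` (mean value theorem along
the ray from the circle, where `ρ = 1`), so the last term is at most `κ (4M₁ + 2) ≤ m/2` for the
cutoff with `κ = m/(2(4M₁ + 2))`: **`E_u' > 0` on `[1 - τ/2, 1 + τ₁)`**.  This file proves exactly this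
(`FriendsCarrierVk.exists_rayMono`), the analytic heart of the ray reparametrisation of Part B.

No definitions, no named facts, no `sorry`.
-/

-- the prescribed namespace `Summit.<P>.<Sub>.…` duplicates `SmoothPoincare4` (P = Sub)
set_option linter.dupNamespace false
set_option linter.style.longLine false

noncomputable section

open scoped ContDiff Topology
open Set Function Metric Filter

namespace Summit.SmoothPoincare4.SmoothPoincare4.Theorems.DcrGap.MkFriends

namespace FriendsCarrierVk

/-! ## Uniform bounds for the radial derivative -/

/-- **Bounds for the radial derivative on a compact annulus.**  If `ρ` is `C^∞` with `dρₓ(x) > 0` on the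
open annulus `|‖x‖ - 1| < τ`, then `0 < m₁ ≤ dρₓ(x) ≤ M₁` on `1 - τ/2 ≤ ‖x‖ ≤ 1 + τ/2`. [folklore] -/
theorem exists_ray_deriv_bounds {ρ : (EuclideanSpace ℝ (Fin 2)) → ℝ} {τ : ℝ} (hτ : 0 < τ)
    (hρs : ∀ x : (EuclideanSpace ℝ (Fin 2)), |‖x‖ - 1| < τ → ContDiffAt ℝ ∞ ρ x)
    (hρd : ∀ x : (EuclideanSpace ℝ (Fin 2)), |‖x‖ - 1| < τ → 0 < fderiv ℝ ρ x x) :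
    ∃ m₁ M₁ : ℝ, 0 < m₁ ∧ m₁ ≤ M₁ ∧ ∀ x : (EuclideanSpace ℝ (Fin 2)), 1 - τ / 2 ≤ ‖x‖ → ‖x‖ ≤ 1 + τ / 2 →
      m₁ ≤ fderiv ℝ ρ x x ∧ fderiv ℝ ρ x x ≤ M₁ := by
  set U : Set (EuclideanSpace ℝ (Fin 2)) := {x | |‖x‖ - 1| < τ} with hU
  have hUo : IsOpen U := isOpen_lt (continuous_abs.comp (continuous_norm.sub continuous_const)) continuous_const
  have hon : ContDiffOn ℝ ∞ ρ U := fun x hx => (hρs x hx).contDiffWithinAt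
  set Z : Set (EuclideanSpace ℝ (Fin 2)) := {x | 1 - τ / 2 ≤ ‖x‖ ∧ ‖x‖ ≤ 1 + τ / 2} with hZ
  have hZU : Z ⊆ U := fun x hx => by
    show |‖x‖ - 1| < τ
    rw [abs_lt]; obtain ⟨h1, h2⟩ := hx; constructor <;> linarith
  have hZc : IsCompact Z := by
    have : Z = closedBall (0 : (EuclideanSpace ℝ (Fin 2))) (1 + τ / 2) ∩ {x | 1 - τ / 2 ≤ ‖x‖} := by
      ext x; simp only [hZ, mem_setOf_eq, mem_inter_iff, mem_closedBall, dist_zero_right]; tauto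
    rw [this]
    exact (isCompact_closedBall _ _).inter_right (isClosed_le continuous_const continuous_norm)
  have hcont : ContinuousOn (fun x => fderiv ℝ ρ x x) Z := by
    intro x hx
    have h1 : ContinuousAt (fun x => fderiv ℝ ρ x) x :=
      (hon.continuousOn_fderiv_of_isOpen hUo (by simp)).continuousAt (hUo.mem_nhds (hZU hx))
    exact (h1.clm_apply continuousAt_id).continuousWithinAt
  have hZne : Z.Nonempty := ⟨EuclideanSpace.single 0 1, by simp [hZ]; positivity⟩
  obtain ⟨x₀, hx₀, hmin⟩ := hZc.exists_isMinOn hZne hcont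
  obtain ⟨x₁, hx₁, hmax⟩ := hZc.exists_isMaxOn hZne hcont
  refine ⟨fderiv ℝ ρ x₀ x₀, fderiv ℝ ρ x₁ x₁, hρd x₀ (hZU hx₀), hmin hx₁, fun x h1 h2 => ⟨hmin ⟨h1, h2⟩, hmax ⟨h1, h2⟩⟩⟩

/-! ## Along a ray: the mean value estimate and the logarithm -/

/-- The derivative of `ρ` along the ray `s ↦ s • u` through a unit vector. [folklore] -/
theorem hasDerivAt_ray {ρ : (EuclideanSpace ℝ (Fin 2)) → ℝ} {τ : ℝ} (hρs : ∀ x : (EuclideanSpace ℝ (Fin 2)), |‖x‖ - 1| < τ → ContDiffAt ℝ ∞ ρ x)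
    {u : (EuclideanSpace ℝ (Fin 2))} (hu : ‖u‖ = 1) {s : ℝ} (hs : |s - 1| < τ) (hs0 : 0 < s) :
    HasDerivAt (fun s : ℝ => ρ (s • u)) (fderiv ℝ ρ (s • u) u) s := by
  have hn : ‖s • u‖ = s := by rw [norm_smul, hu, mul_one, Real.norm_eq_abs, abs_of_pos hs0]
  have hline : HasDerivAt (fun s : ℝ => s • u) u s := by simpa using (hasDerivAt_id s).smul_const u
  exact ((hρs _ (by rwa [hn])).differentiableAt (by simp)).hasFDerivAt.comp_hasDerivAt_of_eq s hline rfl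

/-- Radial derivative in the unit direction versus in the direction `x = s • u`. [folklore] -/
theorem fderiv_ray_unit {ρ : (EuclideanSpace ℝ (Fin 2)) → ℝ} {u : (EuclideanSpace ℝ (Fin 2))} {s : ℝ} (hs0 : 0 < s) :
    fderiv ℝ ρ (s • u) u = s⁻¹ * fderiv ℝ ρ (s • u) (s • u) := by
  rw [map_smul, smul_eq_mul, ← mul_assoc, inv_mul_cancel₀ hs0.ne', one_mul]

/-- **Mean value estimate along a ray from the circle**: with `ρ = 1` on the circle and
`0 ≤ dρₓ(x) ≤ M₁` on the annulus `1 - τ/2 ≤ ‖x‖ ≤ 1 + τ/2`, for a unit vector `u` and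
`1 - τ/2 ≤ t ≤ 1` one has `0 ≤ 1 - ρ(t u) ≤ 2 M₁ (1 - t)`. [folklore] -/
theorem ray_mvt {ρ : (EuclideanSpace ℝ (Fin 2)) → ℝ} {τ M₁ : ℝ} (hτ : 0 < τ) (hτh : τ ≤ 1 / 2)
    (hρs : ∀ x : (EuclideanSpace ℝ (Fin 2)), |‖x‖ - 1| < τ → ContDiffAt ℝ ∞ ρ x)
    (hbd : ∀ x : (EuclideanSpace ℝ (Fin 2)), 1 - τ / 2 ≤ ‖x‖ → ‖x‖ ≤ 1 + τ / 2 → 0 ≤ fderiv ℝ ρ x x ∧ fderiv ℝ ρ x x ≤ M₁)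
    (hone : ∀ x : (EuclideanSpace ℝ (Fin 2)), ‖x‖ = 1 → ρ x = 1)
    {u : (EuclideanSpace ℝ (Fin 2))} (hu : ‖u‖ = 1) {t : ℝ} (ht1 : 1 - τ / 2 ≤ t) (ht2 : t ≤ 1) :
    0 ≤ 1 - ρ (t • u) ∧ 1 - ρ (t • u) ≤ 2 * M₁ * (1 - t) := by
  set g : ℝ → ℝ := fun s => ρ (s • u) with hg
  have hsn : ∀ s : ℝ, 0 < s → ‖s • u‖ = s := fun s hs => by
    rw [norm_smul, hu, mul_one, Real.norm_eq_abs, abs_of_pos hs]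
  have hder : ∀ s ∈ Icc t 1, HasDerivAt g (fderiv ℝ ρ (s • u) u) s := by
    intro s hs
    have hs0 : 0 < s := by linarith [hs.1]
    exact hasDerivAt_ray hρs hu (by rw [abs_lt]; constructor <;> linarith [hs.1, hs.2]) hs0
  have hcont : ContinuousOn g (Icc t 1) := fun s hs => (hder s hs).continuousAt.continuousWithinAt
  have hdiff : DifferentiableOn ℝ g (interior (Icc t 1)) := fun s hs =>
    (hder s (interior_subset hs)).differentiableAt.differentiableWithinAt
  have hbounds : ∀ s ∈ interior (Icc t 1), 0 ≤ deriv g s ∧ deriv g s ≤ 2 * M₁ := by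
    intro s hs
    rw [interior_Icc] at hs
    have hs0 : 0 < s := by linarith [hs.1]
    have hsI : s ∈ Icc t 1 := Ioo_subset_Icc_self hs
    rw [(hder s hsI).deriv, fderiv_ray_unit hs0]
    obtain ⟨h0, hM⟩ := hbd (s • u) (by rw [hsn s hs0]; linarith [hs.1]) (by rw [hsn s hs0]; linarith [hs.2])
    have hsinv : 0 < s⁻¹ := inv_pos.2 hs0
    have hsinv2 : s⁻¹ ≤ 2 := by rw [inv_le_comm₀ hs0 two_pos]; linarith [hs.1]
    have hM0 : 0 ≤ M₁ := h0.trans hM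
    exact ⟨mul_nonneg hsinv.le h0, by nlinarith⟩
  have hg1 : g 1 = 1 := by simp only [hg, one_smul]; exact hone u hu
  have ht1mem : (1 : ℝ) ∈ Icc t 1 := ⟨ht2, le_rfl⟩
  have htmem : t ∈ Icc t 1 := ⟨le_rfl, ht2⟩
  have hup := (convex_Icc t 1).image_sub_le_mul_sub_of_deriv_le hcont hdiff (fun s hs => (hbounds s hs).2) t htmem 1 ht1mem ht2
  have hlo := (convex_Icc t 1).mul_sub_le_image_sub_of_le_deriv hcont hdiff (fun s hs => (hbounds s hs).1) t htmem 1 ht1mem ht2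
  rw [hg1] at hup hlo
  constructor <;> nlinarith

/-- `|log y| ≤ 2 |y - 1|` for `y ≥ 1/2`. [folklore] -/
theorem abs_log_le {y : ℝ} (hy : 1 / 2 ≤ y) : |Real.log y| ≤ 2 * |y - 1| := by
  have hy0 : 0 < y := by linarith
  rcases le_or_gt 1 y with h1 | h1
  · rw [abs_of_nonneg (Real.log_nonneg h1), abs_of_nonneg (by linarith)]
    linarith [Real.log_le_sub_one_of_pos hy0]
  · rw [abs_of_neg (Real.log_neg hy0 h1), abs_of_neg (by linarith)]
    have h2 := Real.one_sub_inv_le_log_of_pos hy0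
    have h3 : y⁻¹ ≤ 2 := by rw [inv_le_comm₀ hy0 two_pos]; linarith
    have h4 : y⁻¹ - 1 = (1 - y) * y⁻¹ := by field_simp
    nlinarith

/-! ## The blended exponent and its derivative -/

/-- **The derivative of the blended exponent** `E_u(t) = log t + β(t) (log ρ(t u) - log t)`. [folklore] -/
theorem hasDerivAt_rayExponent {ρ : (EuclideanSpace ℝ (Fin 2)) → ℝ} {β : ℝ → ℝ} {τ : ℝ}
    (hρs : ∀ x : (EuclideanSpace ℝ (Fin 2)), |‖x‖ - 1| < τ → ContDiffAt ℝ ∞ ρ x) (hρpos : ∀ x : (EuclideanSpace ℝ (Fin 2)), |‖x‖ - 1| < τ → 0 < ρ x)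
    (hβ : ContDiff ℝ ∞ β) {u : (EuclideanSpace ℝ (Fin 2))} (hu : ‖u‖ = 1) {t : ℝ} (ht : |t - 1| < τ) (ht0 : 0 < t) :
    HasDerivAt (fun t : ℝ => Real.log t + β t * (Real.log (ρ (t • u)) - Real.log t))
      (t⁻¹ + (deriv β t * (Real.log (ρ (t • u)) - Real.log t) +
        β t * (fderiv ℝ ρ (t • u) u / ρ (t • u) - t⁻¹))) t := by
  have hn : ‖t • u‖ = t := by rw [norm_smul, hu, mul_one, Real.norm_eq_abs, abs_of_pos ht0]
  have hlog : HasDerivAt Real.log t⁻¹ t := Real.hasDerivAt_log ht0.ne'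
  have hβd : HasDerivAt β (deriv β t) t := ((hβ.differentiable (by simp)) t).hasDerivAt
  have hρr : HasDerivAt (fun s : ℝ => ρ (s • u)) (fderiv ℝ ρ (t • u) u) t := hasDerivAt_ray hρs hu ht ht0
  have hlogρ : HasDerivAt (fun s : ℝ => Real.log (ρ (s • u))) (fderiv ℝ ρ (t • u) u / ρ (t • u)) t :=
    hρr.log (hρpos _ (by rwa [hn])).ne'
  exact hlog.add (hβd.mul (hlogρ.sub hlog))

/-- **The monotonicity datum of the ray reparametrisation.**  For `ρ` as above there are a `C^∞`
cutoff `β : ℝ → [0, 1]` and `τ₁ ∈ (0, τ/2)` with `β = 0` on `t ≤ 1 - τ/2`, `β = 1` on `t ≥ 1 - τ₁`,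
such that for every unit vector `u` and every `t ∈ [1 - τ/2, 1 + τ₁)` the blended exponent
`E_u(t) = log t + β(t) (log ρ(t u) - log t)` has a POSITIVE derivative. [folklore] -/
theorem exists_rayMono {ρ : (EuclideanSpace ℝ (Fin 2)) → ℝ} {τ : ℝ} (hτ : 0 < τ) (hτh : τ ≤ 1 / 2)
    (hρs : ∀ x : (EuclideanSpace ℝ (Fin 2)), |‖x‖ - 1| < τ → ContDiffAt ℝ ∞ ρ x)
    (hρ1 : ∀ x : (EuclideanSpace ℝ (Fin 2)), |‖x‖ - 1| < τ → |ρ x - 1| < 1 / 2)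
    (hρd : ∀ x : (EuclideanSpace ℝ (Fin 2)), |‖x‖ - 1| < τ → 0 < fderiv ℝ ρ x x)
    (hone : ∀ x : (EuclideanSpace ℝ (Fin 2)), ‖x‖ = 1 → ρ x = 1) :
    ∃ (β : ℝ → ℝ) (τ₁ : ℝ), 0 < τ₁ ∧ τ₁ < τ / 2 ∧ ContDiff ℝ ∞ β ∧ (∀ t, 0 ≤ β t ∧ β t ≤ 1) ∧
      (∀ t, t ≤ 1 - τ / 2 → β t = 0) ∧ (∀ t, 1 - τ₁ ≤ t → β t = 1) ∧
      ∀ (u : (EuclideanSpace ℝ (Fin 2))), ‖u‖ = 1 → ∀ t : ℝ, 1 - τ / 2 ≤ t → t < 1 + τ₁ →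
        ∃ e : ℝ, 0 < e ∧ HasDerivAt (fun t : ℝ => Real.log t + β t * (Real.log (ρ (t • u)) - Real.log t)) e t := by
  -- the bounds and the constants
  obtain ⟨m₁, M₁, hm₁, hm₁M₁, hbd⟩ := exists_ray_deriv_bounds hτ hρs hρd
  have hM₁ : 0 < M₁ := lt_of_lt_of_le hm₁ hm₁M₁
  set A : ℝ := 4 * M₁ + 2 with hA
  have hApos : 0 < A := by rw [hA]; positivity
  set m : ℝ := min 1 (2 * m₁ / 3) with hm
  have hmpos : 0 < m := lt_min one_pos (by positivity)
  set κ : ℝ := m / (2 * A) with hκ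
  have hκpos : 0 < κ := by rw [hκ]; positivity
  have hκA : κ * A = m / 2 := by rw [hκ]; field_simp
  have hτ2 : 0 < τ / 2 := by positivity
  obtain ⟨β, τ₁, hτ₁, hτ₁τ, hβs, hβ01, hβzero, hβone, hβd⟩ := exists_logCutoff hτ2 hκpos
  have hρpos : ∀ x : (EuclideanSpace ℝ (Fin 2)), |‖x‖ - 1| < τ → 0 < ρ x := fun x hx => by
    have := abs_lt.1 (hρ1 x hx); linarith
  refine ⟨β, τ₁, hτ₁, hτ₁τ, hβs, hβ01, hβzero, hβone, fun u hu t ht1 ht2 => ?_⟩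
  have ht0 : 0 < t := by linarith
  have htτ : |t - 1| < τ := by rw [abs_lt]; constructor <;> linarith
  have hn : ‖t • u‖ = t := by rw [norm_smul, hu, mul_one, Real.norm_eq_abs, abs_of_pos ht0]
  have hxτ : |‖t • u‖ - 1| < τ := by rwa [hn]
  refine ⟨_, ?_, hasDerivAt_rayExponent hρs hρpos hβs hu htτ ht0⟩
  -- positivity of the derivative
  have hρx : 0 < ρ (t • u) := hρpos _ hxτ
  have hρlt : ρ (t • u) < 3 / 2 := by have := abs_lt.1 (hρ1 _ hxτ); linarith
  have hρge : 1 / 2 ≤ ρ (t • u) := by have := abs_lt.1 (hρ1 _ hxτ); linarith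
  have hdu : fderiv ℝ ρ (t • u) u = t⁻¹ * fderiv ℝ ρ (t • u) (t • u) := fderiv_ray_unit ht0
  obtain ⟨hlow, -⟩ := hbd (t • u) (by rw [hn]; exact ht1) (by rw [hn]; linarith)
  have hβt := hβ01 t
  by_cases hcase : 1 - τ₁ < t
  · -- near and beyond the circle: `β = 1` near `t`, so `β' = 0`
    have hev : β =ᶠ[𝓝 t] fun _ => (1 : ℝ) := by
      filter_upwards [Ioi_mem_nhds hcase] with s hs
      exact hβone s hs.le
    have hd0 : deriv β t = 0 := by rw [hev.deriv_eq, deriv_const]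
    have hX : 0 < fderiv ℝ ρ (t • u) u / ρ (t • u) :=
      div_pos (by rw [hdu]; exact mul_pos (inv_pos.2 ht0) (lt_of_lt_of_le hm₁ hlow)) hρx
    have key : t⁻¹ + (0 * (Real.log (ρ (t • u)) - Real.log t) + 1 * (fderiv ℝ ρ (t • u) u / ρ (t • u) - t⁻¹)) =
        fderiv ℝ ρ (t • u) u / ρ (t • u) := by ring
    rw [hd0, hβone t hcase.le, key]
    exact hX
  · -- the blending zone: `t ≤ 1 - τ₁ < 1`
    push Not at hcase
    have ht1' : t < 1 := by linarith
    -- the main terms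
    have hterm2 : 2 * m₁ / 3 ≤ fderiv ℝ ρ (t • u) u / ρ (t • u) := by
      rw [hdu, le_div_iff₀ hρx]
      have h1 : m₁ ≤ t⁻¹ * fderiv ℝ ρ (t • u) (t • u) := by
        have hti : 1 ≤ t⁻¹ := by rw [le_inv_comm₀ one_pos ht0, inv_one]; exact ht1'.le
        nlinarith [lt_of_lt_of_le hm₁ hlow]
      nlinarith
    have hmain : m ≤ (1 - β t) * t⁻¹ + β t * (fderiv ℝ ρ (t • u) u / ρ (t • u)) := by
      have hti : 1 ≤ t⁻¹ := by rw [le_inv_comm₀ one_pos ht0, inv_one]; exact ht1'.le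
      have h1 : m ≤ 1 := min_le_left _ _
      have h2 : m ≤ 2 * m₁ / 3 := min_le_right _ _
      nlinarith [hβt.1, hβt.2]
    -- the error term
    obtain ⟨hmv0, hmv⟩ := ray_mvt hτ hτh hρs (fun x h1 h2 => ⟨(lt_of_lt_of_le hm₁ (hbd x h1 h2).1).le, (hbd x h1 h2).2⟩)
      hone hu ht1 ht1'.le
    have hΛ : |Real.log (ρ (t • u)) - Real.log t| ≤ A * (1 - t) := by
      have h1 : |Real.log (ρ (t • u))| ≤ 2 * |ρ (t • u) - 1| := abs_log_le hρge
      have h2 : |ρ (t • u) - 1| ≤ 2 * M₁ * (1 - t) := by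
        rw [abs_sub_comm, abs_of_nonneg hmv0]; exact hmv
      have h3 : |Real.log t| ≤ 2 * |t - 1| := abs_log_le (by linarith)
      have h4 : |t - 1| = 1 - t := by rw [abs_sub_comm, abs_of_nonneg (by linarith)]
      calc |Real.log (ρ (t • u)) - Real.log t| ≤ |Real.log (ρ (t • u))| + |Real.log t| := abs_sub _ _
        _ ≤ 2 * (2 * M₁ * (1 - t)) + 2 * (1 - t) := by rw [h4] at h3; nlinarith
        _ = A * (1 - t) := by rw [hA]; ring
    have herr : |deriv β t * (Real.log (ρ (t • u)) - Real.log t)| ≤ m / 2 := by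
      rw [abs_mul]
      have h1t : 0 < 1 - t := by linarith
      have hb := hβd t ht1'
      calc |deriv β t| * |Real.log (ρ (t • u)) - Real.log t| ≤ |deriv β t| * (A * (1 - t)) :=
            mul_le_mul_of_nonneg_left hΛ (abs_nonneg _)
        _ = |deriv β t| * (1 - t) * A := by ring
        _ ≤ κ * A := mul_le_mul_of_nonneg_right hb hApos.le
        _ = m / 2 := hκA
    have herr' := (abs_le.1 herr).1
    have hrew : t⁻¹ + (deriv β t * (Real.log (ρ (t • u)) - Real.log t) + β t * (fderiv ℝ ρ (t • u) u / ρ (t • u) - t⁻¹)) =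
        ((1 - β t) * t⁻¹ + β t * (fderiv ℝ ρ (t • u) u / ρ (t • u))) + deriv β t * (Real.log (ρ (t • u)) - Real.log t) := by
      ring
    rw [hrew]
    linarith

end FriendsCarrierVk

open FriendsCarrierVk in
/-- **Helper `helper_friendsCarrier_Vk_partB_rayMono`** (piece of the registered stub
`helper_friendsCarrier_Vk_partB`: monotonicity datum of the ray reparametrisation).  For `ρ` smooth on
the annulus `|‖x‖ - 1| < τ` with `|ρ - 1| < 1/2`, positive radial derivative and `ρ = 1` on the circle,
there is a logarithmic cutoff `β` (`0` below `1 - τ/2`, `1` above `1 - τ₁`) for which the blended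
exponent `log t + β(t)(log ρ(t u) - log t)` has positive derivative on `[1 - τ/2, 1 + τ₁)` along every
unit ray. [folklore] -/
theorem helper_friendsCarrier_Vk_partB_rayMono : ∀ (ρ : EuclideanSpace ℝ (Fin 2) → ℝ) (τ : ℝ), 0 < τ → τ ≤ 1 / 2 → (∀ x : EuclideanSpace ℝ (Fin 2), |‖x‖ - 1| < τ → ContDiffAt ℝ ((⊤ : ℕ∞) : WithTop ℕ∞) ρ x) → (∀ x : EuclideanSpace ℝ (Fin 2), |‖x‖ - 1| < τ → |ρ x - 1| < 1 / 2) → (∀ x : EuclideanSpace ℝ (Fin 2), |‖x‖ - 1| < τ → 0 < fderiv ℝ ρ x x) → (∀ x : EuclideanSpace ℝ (Fin 2), ‖x‖ = 1 → ρ x = 1) → ∃ (β : ℝ → ℝ) (τ₁ : ℝ), 0 < τ₁ ∧ τ₁ < τ / 2 ∧ ContDiff ℝ ((⊤ : ℕ∞) : WithTop ℕ∞) β ∧ (∀ t, 0 ≤ β t ∧ β t ≤ 1) ∧ (∀ t, t ≤ 1 - τ / 2 → β t = 0) ∧ (∀ t, 1 - τ₁ ≤ t → β t = 1) ∧ ∀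 (u : EuclideanSpace ℝ (Fin 2)), ‖u‖ = 1 → ∀ t : ℝ, 1 - τ / 2 ≤ t → t < 1 + τ₁ → ∃ e : ℝ, 0 < e ∧ HasDerivAt (fun t : ℝ => Real.log t + β t * (Real.log (ρ (t • u)) - Real.log t)) e t :=
  fun _ _ hτ hτh hρs hρ1 hρd hone => exists_rayMono hτ hτh hρs hρ1 hρd hone

end Summit.SmoothPoincare4.SmoothPoincare4.Theorems.DcrGap.MkFriends

end
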